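import Mathlib
import Summits.NavierStokesRegularity.NavierStokesRegularity.Theses.RootDecompLitSlice
import Summits.NavierStokesRegularity.NavierStokesRegularity.Theorems.RootDecompLitSliceFourFifthsVisibleScarClosed
import HarnessLib

/-!
# Route RootDecompLitSlice — support HV `HalfVisibleScar` CLOSED (stmt-NavierStokesRegularity-31792)

`Summit.NavierStokesRegularity.NavierStokesRegularity.Theses.RootDecompLitSlice.HalfVisibleScar`
— «half visibility of critically tame scars» on the classical Leray–Hopf frame (classical on `[0,T)`,
Leray–Hopf on `[0,T]`, rapidly decaying datum; critically tame: `∫|u(t)−u(T)|² ≤ K√(T−t)` near `T`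
⟹ `∫_{B_r(x₀)}|u(T)|² ≤ C√r` for small `r`, at every `x₀`) — follows from the sharper HV♯
`FourFifthsVisibleScar` ⟨27391⟩ (now the kernel theorem `Theorems.fourFifthsVisibleScar`, the
clock→scar law at `b = 1/2`): `r^{4/5} ≤ √r` for `r ≤ 1`. Port of the writer g32 kernel edge
`WriterG32.halfVisibleScar_of_fourFifths` (evidence file ScarExponentDial_g32.lean, sha256
a2b70d2daa73) with its hypothesis discharged: HV's filed rung is superseded, not contradicted.

HONEST FRAMING: HV is route-internal SUPPORT (rank 9; the originally filed BC5 rung of Uᶜ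
`CritTameScarIsCritical` ⟨31733⟩, superseded by HV♯); no load of the route moves (ROOT ⟺ U ∧ P1,
critic rows 354/371/563). Rung 0: nothing here proves NS regularity. Decomp-ns route-writer g36.
[folklore]
-/

set_option linter.dupNamespace false

namespace Summit.NavierStokesRegularity.NavierStokesRegularity.Theorems

/-- **Support HV `HalfVisibleScar` of route RootDecompLitSlice, by name**: from the landed HV♯
`fourFifthsVisibleScar` and `r^{4/5} ≤ √r` (`0 < r ≤ 1`). Route-internal support; decorative for the
summit (D-0179). [folklore] -/
theorem halfVisibleScar :
    Summit.NavierStokesRegularity.NavierStokesRegularity.Theses.RootDecompLitSlice.HalfVisibleScar := by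
  intro ν T hν hT u p hcl hLH hdec hclock x₀
  obtain ⟨C, r₁, hr₁, hC⟩ := fourFifthsVisibleScar ν T hν hT u p hcl hLH hdec hclock x₀
  refine ⟨max C 0, min r₁ 1, lt_min hr₁ one_pos, fun r hr => ?_⟩
  have hr0 : 0 < r := hr.1
  have hrr₁ : r < r₁ := lt_of_lt_of_le hr.2 (min_le_left _ _)
  have hr1 : r ≤ 1 := hr.2.le.trans (min_le_right _ _)
  have hpow : r ^ (4 / 5 : ℝ) ≤ Real.sqrt r := by
    rw [Real.sqrt_eq_rpow]
    exact Real.rpow_le_rpow_of_exponent_ge hr0 hr1 (by norm_num)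
  calc ∫ x in Metric.ball x₀ r, ‖u T x‖ ^ 2 ≤ C * r ^ (4 / 5 : ℝ) := hC r ⟨hr0, hrr₁⟩
    _ ≤ max C 0 * r ^ (4 / 5 : ℝ) :=
        mul_le_mul_of_nonneg_right (le_max_left _ _) (Real.rpow_nonneg hr0.le _)
    _ ≤ max C 0 * Real.sqrt r := mul_le_mul_of_nonneg_left hpow (le_max_right _ _)

end Summit.NavierStokesRegularity.NavierStokesRegularity.Theorems
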